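import Mathlib
import Summits.Ventures.PercRepro2.SwSide

/-!
# Row (SW-side) in injection form (blind cell PercRepro2, night-4 g4, 2026-08-24; proofs/NIGHT4-SIDE.md §2)

By Hall's marriage theorem, `SwSide.card_side_le` (the counting form of row (SW-side), valid for every
family `𝓥`) gives the INJECTION form: there is an injection of `{o ∈ R_side, h ∈ B_side}` into
`{o ∈ R_side, h ∈ R_side}` carrying the red cluster of `h` into the blue cluster of `h` of the image
(`exists_sideInj`).  This is the map `ψ₁` of the cut-vertex composition of row (SW)
(NIGHT4-SIDE.md §5): the companion of `LocRows.Sw` with `h` on a side of the hull of `l`.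
-/

namespace Summit.Ventures.PercRepro2

namespace SwSide

open Hull

open scoped Classical

variable {V : Type*} {E : Type*} [Fintype E] [DecidableEq E]

variable (ends : E → Sym2 V)

/-- The source side of (SW-side): `{o ∈ R_side, h ∈ B_side}`. -/
noncomputable def srcSide (l h o : V) : Finset (Config E) :=
  Finset.univ.filter fun ζ => o ∈ rside ends ζ l ∧ h ∈ bside ends ζ l

/-- The target side of (SW-side): `{o ∈ R_side, h ∈ R_side}`. -/
noncomputable def tgtSide (l h o : V) : Finset (Config E) :=
  Finset.univ.filter fun ζ => o ∈ rside ends ζ l ∧ h ∈ rside ends ζ l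

/-- **Row (SW-side), injection form** (Hall): an injection `{o ∈ R_side, h ∈ B_side} →
{o ∈ R_side, h ∈ R_side}` with `C_R(h)(ζ) ⊆ C_B(h)(ψ ζ)`. -/
theorem exists_sideInj (l h o : V) :
    ∃ f : {ζ // ζ ∈ srcSide ends l h o} → Config E, Function.Injective f ∧
      ∀ x, f x ∈ tgtSide ends l h o ∧ cluster ends x.1 h ⊆ cluster ends (blue (f x)) h := by
  let t : {ζ // ζ ∈ srcSide ends l h o} → Finset (Config E) := fun x =>
    (tgtSide ends l h o).filter fun ζ' => cluster ends x.1 h ⊆ cluster ends (blue ζ') h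
  have hall : ∀ s : Finset {ζ // ζ ∈ srcSide ends l h o}, s.card ≤ (s.biUnion t).card := by
    intro s
    let 𝓥 : Set (Set V) := {S | ∃ x ∈ s, cluster ends x.1 h ⊆ S}
    have e1 : s.biUnion t =
        Finset.univ.filter fun ζ : Config E =>
          o ∈ rside ends ζ l ∧ h ∈ rside ends ζ l ∧ cluster ends (blue ζ) h ∈ 𝓥 := by
      ext ζ'
      simp only [Finset.mem_biUnion, Finset.mem_filter, t, 𝓥, Set.mem_setOf_eq, tgtSide,
        Finset.mem_univ, true_and]
      constructor
      · rintro ⟨x, hx, ⟨h1, h2⟩, hsub⟩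
        exact ⟨h1, h2, x, hx, hsub⟩
      · rintro ⟨h1, h2, x, hx, hsub⟩
        exact ⟨x, hx, ⟨h1, h2⟩, hsub⟩
    have e2 : s.card ≤ (Finset.univ.filter fun ζ : Config E =>
        o ∈ rside ends ζ l ∧ h ∈ bside ends ζ l ∧ cluster ends ζ h ∈ 𝓥).card := by
      refine Finset.card_le_card_of_injOn (fun x => x.1) ?_ ?_
      · intro x hx
        rw [Finset.mem_coe] at hx
        have hx1 := x.2
        simp only [srcSide, Finset.mem_filter, Finset.mem_univ, true_and] at hx1
        simp only [Finset.mem_coe, Finset.mem_filter, Finset.mem_univ, true_and]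
        exact ⟨hx1.1, hx1.2, x, hx, subset_rfl⟩
      · intro x _ y _ hxy
        exact Subtype.ext hxy
    rw [e1]
    refine Nat.le_trans e2 ?_
    convert card_side_le (ends := ends) l h o 𝓥 using 4
  obtain ⟨f, hf, hft⟩ := (Finset.all_card_le_biUnion_card_iff_exists_injective t).1 hall
  refine ⟨f, hf, fun x => ?_⟩
  have := hft x
  simp only [t, Finset.mem_filter] at this
  exact this

end SwSide

end Summit.Ventures.PercRepro2
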